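import Summits.ResolutionOfSingularities.KangarooAtlas.MizutaniDegeneration
import HarnessLib

/-!
# Mizutani's conjecture `m(e) = 2p^e − 1` — the polynomial tower model, V: exposed vertices (Corollary D‴)

Cell topic `Summits/ResolutionOfSingularities/KangarooAtlas` (pub-rosobs); namespace
`Summit.ResolutionOfSingularities.KangarooAtlas.Mizutani`.  Continuation of `MizutaniDegeneration`
(MIZUTANI-PROOF-g59 §5, COROLLARY D‴ in model form).  In-house chain, AI-written; not a resolution
theorem.

COROLLARY D‴ (vertices).  Let the weights `w` be POSITIVE on every coefficient variable and let
`P` be a `t`-exponent of `ω` whose coefficient has a non-zero constant term `c₀ = κ_P(0)` and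
whose `t`-weight `w·P` is STRICTLY smaller than that of every other `t`-exponent of `ω`.  Then every
term `κ_{M,V} a^V t^M` other than `c₀ t^P` has weight `w·V + w·M > w·P`, so the initial form is
`in_w ω = c₀ t^P`, and Theorem D gives `σ_n(ω) ≥ σ_n(c₀ t^P) ≥ #{T ∈ Box : |T| ≤ n, C(P,T) ≠ 0}`
(`card_le_profile_of_vertex`, with part II's MONOMIALS bound).  The explicit degeneration family
is `torusShift` (`Ω' = Σ_M Λ^{w·M − w·P} θ_Λ(κ_M) t^M`).

References: [Mizutani1973HironakaGroupSchemes] (Remark 2.10); [Oda1983HironakaGroupSchemeII]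
(§1 p. 1166); [EGAIV4] Thm. 16.11.2.
-/

open MvPolynomial Literature.AlgebraicGeometry.Resolution

namespace Summit.ResolutionOfSingularities.KangarooAtlas.Mizutani

section Vertex

variable {ι κ F : Type*} [Field F] [Fintype ι] (e : ι → κ)

/-- The torus on a monomial: `θ(κ t^N) = s^{w·N} θ(κ) t^N`.
[cite: Mizutani1973HironakaGroupSchemes, Remark 2.10 (in-house proof, §5 tori)] -/
theorem torus_monomial (s : MvPolynomial κ F) (w : κ → ℕ) (N : ι →₀ ℕ) (a : MvPolynomial κ F) :
    torus e s w (monomial N a) = monomial N (s ^ twt e w N * torusCoeff s w a) := by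
  classical
  ext M
  rw [coeff_torus, coeff_monomial, coeff_monomial]
  split_ifs with h
  · rw [h]
  · rw [map_zero, mul_zero]

/-- The `t`-weights of the extended model agree with the original ones. [folklore] -/
@[simp] theorem twt_ePlus_wPlus (w : κ → ℕ) (M : ι →₀ ℕ) :
    twt (ePlus e) (wPlus w) M = twt e w M := rfl

/-- `Λ ↦ c` after the parametric torus and the inclusion is the torus with scalar `c`:
`evalAt c ∘ θ_Λ ∘ incl = θ_c` on coefficients.
[cite: Mizutani1973HironakaGroupSchemes, Remark 2.10 (in-house proof, §5 Thm D: ω_λ)] -/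
theorem evalAt_torusCoeff_incl (c : F) (w : κ → ℕ) (a : MvPolynomial κ F) :
    evalAt c (torusCoeff (X none : MvPolynomial (Option κ) F) (wPlus w) (incl a)) =
      torusCoeff (C c) w a := by
  have h : ((evalAt c : MvPolynomial (Option κ) F →+* MvPolynomial κ F).comp
      ((torusCoeff (X none : MvPolynomial (Option κ) F) (wPlus w)).toRingHom.comp incl)) =
      (torusCoeff (C c) w).toRingHom := by
    refine MvPolynomial.ringHom_ext (fun x => ?_) (fun k => ?_)
    · simp
    · simp [torusCoeff_X]
  exact RingHom.congr_fun h a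

/-- The torus with scalar `0` and POSITIVE weights evaluates a coefficient at the origin:
`θ_0(κ) = κ(0)`. [cite: Mizutani1973HironakaGroupSchemes, Remark 2.10 (in-house proof, §5 D‴: in_w(A·ω) = κ(0) t^P)] -/
theorem torusCoeff_zero_of_pos {w : κ → ℕ} (hw : ∀ k, 0 < w k) (a : MvPolynomial κ F) :
    torusCoeff (C (0 : F)) w a = C (constantCoeff a) := by
  have hfun : (fun k => C (0 : F) ^ w k * X k : κ → MvPolynomial κ F) = fun _ => 0 := by
    funext k
    rw [map_zero, zero_pow (Nat.pos_iff_ne_zero.mp (hw k)), zero_mul]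
  rw [torusCoeff, hfun, aeval_zero']
  rfl

/-- The explicit degeneration family towards the vertex `P` of `t`-weight `m₀ = w·P`:
`Ω' = Σ_M Λ^{w·M − m₀} · θ_Λ(κ_M) · t^M` (MIZUTANI-PROOF-g59 §5, proof of Thm D: `ω_λ = λ^{m₀}(in_w ω + λρ)`).
[cite: Mizutani1973HironakaGroupSchemes, Remark 2.10 (in-house proof, §5 Thm D)] -/
noncomputable def torusShift (w : κ → ℕ) (m₀ : ℕ) (ω : Rel ι κ F) : Rel ι (Option κ) F :=
  ∑ M ∈ ω.support, monomial M
    ((X none : MvPolynomial (Option κ) F) ^ (twt e w M - m₀) *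
      torusCoeff (X none : MvPolynomial (Option κ) F) (wPlus w) (incl (coeff M ω)))

/-- **Factorisation of the torus family**: if `m₀ ≤ w·M` for every `t`-exponent `M` of `ω`, then
`(θ_Λ ⊗ θ_Λ) ω = Λ^{m₀} · Ω'`. [cite: Mizutani1973HironakaGroupSchemes, Remark 2.10 (in-house proof, §5 Thm D)] -/
theorem torus_incl_eq_torusShift (w : κ → ℕ) (m₀ : ℕ) (ω : Rel ι κ F)
    (hmin : ∀ M ∈ ω.support, m₀ ≤ twt e w M) :
    torus (ePlus e) (X none) (wPlus w) (MvPolynomial.map incl ω) =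
      C ((X none : MvPolynomial (Option κ) F) ^ m₀) * torusShift e w m₀ ω := by
  classical
  conv_lhs => rw [ω.as_sum, map_sum, map_sum]
  rw [torusShift, Finset.mul_sum]
  refine Finset.sum_congr rfl fun M hM => ?_
  rw [map_monomial, torus_monomial, twt_ePlus_wPlus, C_mul_monomial, ← mul_assoc, ← pow_add,
    Nat.add_sub_cancel' (hmin M hM)]

/-- **The special fibre is the vertex monomial**: if the `t`-exponent `P` of `ω` has STRICTLY
smallest `t`-weight and all weights are positive, then `Ω'|_{Λ=0} = κ_P(0) · t^P`.
[cite: Mizutani1973HironakaGroupSchemes, Remark 2.10 (in-house proof, §5 Cor D‴)] -/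
theorem map_evalAt_zero_torusShift {w : κ → ℕ} (hw : ∀ k, 0 < w k) (ω : Rel ι κ F)
    {P : ι →₀ ℕ} (hP : P ∈ ω.support) (hlt : ∀ M ∈ ω.support, M ≠ P → twt e w P < twt e w M) :
    MvPolynomial.map (evalAt 0) (torusShift e w (twt e w P) ω) =
      monomial P (C (constantCoeff (coeff P ω))) := by
  classical
  rw [torusShift, map_sum, Finset.sum_eq_single P]
  · rw [map_monomial, Nat.sub_self, pow_zero, one_mul, evalAt_torusCoeff_incl,
      torusCoeff_zero_of_pos hw]
  · intro M hM hMP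
    rw [map_monomial, map_mul, map_pow, evalAt_X_none, map_zero,
      zero_pow (Nat.sub_ne_zero_of_lt (hlt M hM hMP)), zero_mul, monomial_zero]
  · intro h
    exact absurd hP h

variable [DecidableEq κ] [DecidableEq ι] (q : ℕ)

/-- **COROLLARY D‴ (model form): degeneration to an exposed vertex.**  `F` infinite, `e` injective,
positive weights; if the `t`-exponent `P` of `ω` has strictly smallest `t`-weight then
`σ_n(ω) ≥ σ_n(κ_P(0) · t^P)`. [cite: Mizutani1973HironakaGroupSchemes, Remark 2.10 (in-house proof, §5 COROLLARY D‴)] -/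
theorem profile_monomial_le_of_vertex [Infinite F] (he : Function.Injective e) {w : κ → ℕ}
    (hw : ∀ k, 0 < w k) (ω : Rel ι κ F) {P : ι →₀ ℕ} (hP : P ∈ ω.support)
    (hlt : ∀ M ∈ ω.support, M ≠ P → twt e w P < twt e w M) (n : ℕ) :
    profile e q n (monomial P (C (constantCoeff (coeff P ω)))) ≤ profile e q n ω :=
  profile_le_of_degeneration e q he w (twt e w P) ω _ (torusShift e w (twt e w P) ω)
    (torus_incl_eq_torusShift e w _ ω fun M hM => by
      by_cases h : M = P
      · rw [h]
      · exact le_of_lt (hlt M hM h))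
    (map_evalAt_zero_torusShift e hw ω hP hlt) n

/-- **COROLLARY D‴ with MONOMIALS**: under the same hypotheses, with `P` in the box and
`κ_P(0) ≠ 0`, `σ_n(ω) ≥ #{T ∈ Box : |T| ≤ n, C(P,T) ≠ 0 in F}` (MIZUTANI-PROOF-g59 §5 D‴ with §1.4
MONOMIALS; with Lucas and the Digit Lemma this is `≥ 2n + 1` for genuine `P`).
[cite: Mizutani1973HironakaGroupSchemes, Remark 2.10 (in-house proof, §5 COROLLARY D‴ + §4)] -/
theorem card_le_profile_of_vertex [Infinite F] (he : Function.Injective e) {w : κ → ℕ}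
    (hw : ∀ k, 0 < w k) (ω : Rel ι κ F) {P : Box ι q} (hP : P.toF ∈ ω.support)
    (hc : constantCoeff (coeff P.toF ω) ≠ 0)
    (hlt : ∀ M ∈ ω.support, M ≠ P.toF → twt e w P.toF < twt e w M) (n : ℕ) :
    (open scoped Classical in
      (Finset.univ.filter fun T : Box ι q => T.deg ≤ n ∧ (mchoose P.toF T.toF : F) ≠ 0).card) ≤
      profile e q n ω :=
  le_trans (card_le_profile_monomial e q he n P hc)
    (profile_monomial_le_of_vertex e q he hw ω hP hlt n)

end Vertex

end Summit.ResolutionOfSingularities.KangarooAtlas.Mizutani
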